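import Summits.Ventures.CertifiedArithmetic.LowPrec.GemmEnvelopeRowP5Pipeline
import Summits.Ventures.CertifiedArithmetic.LowPrec.GemmEnvelopePinned

/-!
# GEMM-level envelopes, part (u): THE OUTPUT-LEVEL ONSET LAW, generic half (pub-lowprec gemm gen 23, LXXI-a)

HONEST FRAMING: certified error envelopes and provably optimal rounding/accumulation schemes for
low-precision formats under stated cost models; every table by two implementations; no hardware or vendor
claims.

A kind-(v) row of the decision table («does quantiser Q stay inside the reference constant `C` on the class
`C(κ)`?») is decided at the OUTPUT of the pipeline `c = post(acc(ΣΣ q̂a·q̂b))`, accumulation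
`|acc - ΣΣ q̂a q̂b| ≤ γ·ΣΣ|q̂a q̂b|` (`γ ≤ γ̄`), output `|c - acc| ≤ δ·|acc|` (`δ ≤ δ̄`).  Parts (o)–(t) proved
the two sides of such rows at hand-picked class parameters (`κ ≥ 16384` fails, `κ ≤ 258048/17` holds for
row P5).  This file proves that the EXACT ONSET of an output-level separating witness is a closed-form law
of the caps `(γ̄, δ̄)`, record-generically; part (v) `GemmEnvelopeOnsetP5` instantiates it for row P5.

* `no_output_witness_of_ratio_band` (any finite index type): if every cell of the quantised product is a
  NON-NEGATIVE MULTIPLE `r·(a·b)` of the exact cell with `r ∈ [r_lo, r_hi]`, and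
  `(1 - γ̄)(1 - δ̄)·r_hi ≤ 1 + C`, `1 - (1 - δ̄)(1 + γ̄)·r_lo ≤ C` (`0 ≤ γ̄, δ̄ ≤ 1`, `0 ≤ C`), then for EVERY
  input SOME admissible realisation `(acc, c)` lands inside `C·L` — no input is an output-level witness.
  The realisation is explicit: accumulate at the signed extreme `ΣΣq̂ ± γ̄ΣΣ|q̂|` nearer to `S`, then move
  the output toward `S` by at most `δ̄|acc|`.
* `pipeline_witness_up_of_caps`: conversely a constant-ratio input with `(C + 1)·S < (1 - γ̄)(1 - δ̄)·P`
  separates for EVERY realisation (part (o)'s `pipeline_witness_up` is the instance `(1/2048, 1/257)`); so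
  for a one-ratio family the onset is EXACTLY `(1 - γ̄)(1 - δ̄)·r = 1 + C`.
* `mxCeil_ratio_band` / `mxCeil_cell_ratio`: on `C(κ)` with `κ ≤ 229376/15` every MX-E4M3-ceil element is
  `ρ·v` with `ρ ∈ [16/17, R]` for any `R ≥ max(18/17, κ/14336)` (normal elements: `|ρ - 1| ≤ 1/17`; sliver
  elements round UP to the subnormal-boundary value `X/64`, ratio `X/(64|v|) < κ/14336`); cells carry
  `r ∈ [256/289, R²]`.
* `exists_rat_gt_sq_lt`: a rational strictly inside an open onset window (`m < v`, `v² < T`).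

All statements are exact rational algebra over the kernel definitions `roundNE`, `ceilScale`, `blockMax`;
the caps are hypotheses, not claims about any device.  No `sorry`; axioms `propext`, `Classical.choice`,
`Quot.sound` only.  [cite: RouhaniEtAl2023MX, §5.1] [cite: MicikeviciusEtAl2022, §3]
[cite: Higham2002ASNA, §3.1]
-/

namespace Summit.Ventures.CertifiedArithmetic.LowPrec.GemmEnvelope

open Finset
open Literature.ComputerArithmetic.FloatingPoint
open Literature.ComputerArithmetic.FloatingPoint.Format
open Literature.ComputerArithmetic.FloatingPoint.MiniFloat
open Literature.ComputerArithmetic.FloatingPoint.MXBlock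
open Summit.Ventures.CertifiedArithmetic.LowPrec.SR

/-! ## The law, generic half 1: below the onset no input is an output-level witness -/

/-- Scalar core of the no-witness half: with `r_lo ≤ r`, the «accumulate high, cannot reach `S` from
above» shortfall `1 - (1 - δ̄)(1 + γ̄)·r` is at most `C`. -/
theorem onset_deficit_dn {γ δ C rlo r : ℚ} (hδ1 : δ ≤ 1) (hγ0 : 0 ≤ γ)
    (hdn : 1 - (1 - δ) * (1 + γ) * rlo ≤ C) (hr : rlo ≤ r) :
    1 - (1 - δ) * (1 + γ) * r ≤ C := by
  have h1 : 0 ≤ (1 - δ) * (1 + γ) := mul_nonneg (by linarith) (by linarith)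
  have h2 : (1 - δ) * (1 + γ) * rlo ≤ (1 - δ) * (1 + γ) * r := mul_le_mul_of_nonneg_left hr h1
  linarith

/-- Scalar core of the no-witness half: with `r ≤ r_hi`, the «accumulate low, output low» excess
`(1 - δ̄)(1 - γ̄)·r - 1` is at most `C`. -/
theorem onset_excess_up {γ δ C rhi r : ℚ} (hγ1 : γ ≤ 1) (hδ1 : δ ≤ 1)
    (hup : (1 - γ) * (1 - δ) * rhi ≤ 1 + C) (hr : r ≤ rhi) :
    (1 - δ) * (1 - γ) * r - 1 ≤ C := by
  have h1 : 0 ≤ (1 - δ) * (1 - γ) := mul_nonneg (by linarith) (by linarith)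
  have h2 : (1 - δ) * (1 - γ) * r ≤ (1 - δ) * (1 - γ) * rhi := mul_le_mul_of_nonneg_left hr h1
  linarith

/-- Per-cell form of the two scalar cores: for a cell `p = r·s`, `r ∈ [r_lo, r_hi]`, `0 ≤ r_lo`, both
`s - (1 - δ̄)(p + γ̄|p|) ≤ C|s|` and `(1 - δ̄)(p - γ̄|p|) - s ≤ C|s|`. -/
theorem onset_cell_bounds {s p r rlo rhi γ δ C : ℚ} (hγ0 : 0 ≤ γ) (hγ1 : γ ≤ 1) (hδ1 : δ ≤ 1)
    (hrlo : 0 ≤ rlo) (hlo : rlo ≤ r) (hhi : r ≤ rhi) (hp : p = r * s)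
    (hup : (1 - γ) * (1 - δ) * rhi ≤ 1 + C) (hdn : 1 - (1 - δ) * (1 + γ) * rlo ≤ C) :
    s - (1 - δ) * (p + γ * |p|) ≤ C * |s| ∧ (1 - δ) * (p - γ * |p|) - s ≤ C * |s| := by
  have hr0 : 0 ≤ r := le_trans hrlo hlo
  have hA := onset_deficit_dn hδ1 hγ0 hdn hlo
  have hB := onset_excess_up hγ1 hδ1 hup hhi
  have hpabs : |p| = r * |s| := by rw [hp, abs_mul, abs_of_nonneg hr0]
  rcases le_or_gt 0 s with hs | hs
  · rw [abs_of_nonneg hs] at hpabs ⊢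
    rw [hpabs, hp]
    constructor
    · have e : s - (1 - δ) * (r * s + γ * (r * s)) = (1 - (1 - δ) * (1 + γ) * r) * s := by ring
      rw [e]; exact mul_le_mul_of_nonneg_right hA hs
    · have e : (1 - δ) * (r * s - γ * (r * s)) - s = ((1 - δ) * (1 - γ) * r - 1) * s := by ring
      rw [e]; exact mul_le_mul_of_nonneg_right hB hs
  · have hs' : 0 ≤ -s := by linarith
    rw [abs_of_neg hs] at hpabs ⊢
    rw [hpabs, hp]
    constructor
    · have e : s - (1 - δ) * (r * s + γ * (r * -s)) = ((1 - δ) * (1 - γ) * r - 1) * (-s) := by ring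
      rw [e]; exact mul_le_mul_of_nonneg_right hB hs'
    · have e : (1 - δ) * (r * s - γ * (r * -s)) - s = (1 - (1 - δ) * (1 + γ) * r) * (-s) := by ring
      rw [e]; exact mul_le_mul_of_nonneg_right hA hs'

/-- **THE ONSET LAW, NO-WITNESS HALF (record-generic).**  Cells indexed by a finite type; exact cells `s`,
quantised cells `p` with `p = r·s`, `r ∈ [r_lo, r_hi]`, `0 ≤ r_lo`; caps `0 ≤ γ̄ ≤ 1`, `0 ≤ δ̄ ≤ 1`;
reference constant `0 ≤ C`.  If `(1 - γ̄)(1 - δ̄)·r_hi ≤ 1 + C` and `1 - (1 - δ̄)(1 + γ̄)·r_lo ≤ C` then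
SOME admissible realisation of the pipeline — `|acc - Σp| ≤ γ̄Σ|p|`, `|c - acc| ≤ δ̄|acc|` — satisfies
`|c - Σs| ≤ C·Σ|s|`: the input is not an output-level separating witness against `C`.  (Monotone in the
caps: a realisation admissible at `(γ̄, δ̄)` is admissible at any larger caps.) [cite: Higham2002ASNA, §3.1] -/
theorem no_output_witness_of_ratio_band {ι : Type*} [Fintype ι] (s p : ι → ℚ)
    {rlo rhi γ δ C : ℚ} (hC : 0 ≤ C) (hγ0 : 0 ≤ γ) (hγ1 : γ ≤ 1) (hδ0 : 0 ≤ δ) (hδ1 : δ ≤ 1)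
    (hrlo : 0 ≤ rlo) (hr : ∀ i, ∃ r, rlo ≤ r ∧ r ≤ rhi ∧ p i = r * s i)
    (hup : (1 - γ) * (1 - δ) * rhi ≤ 1 + C) (hdn : 1 - (1 - δ) * (1 + γ) * rlo ≤ C) :
    ∃ acc c : ℚ, |acc - ∑ i, p i| ≤ γ * ∑ i, |p i| ∧ |c - acc| ≤ δ * |acc| ∧
      |c - ∑ i, s i| ≤ C * ∑ i, |s i| := by
  -- per-cell bounds, summed
  have hcell : ∀ i, s i - (1 - δ) * (p i + γ * |p i|) ≤ C * |s i| ∧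
      (1 - δ) * (p i - γ * |p i|) - s i ≤ C * |s i| := by
    intro i
    obtain ⟨r, hlo, hhi, hp⟩ := hr i
    exact onset_cell_bounds hγ0 hγ1 hδ1 hrlo hlo hhi hp hup hdn
  have h1 : ∑ i, s i - (1 - δ) * (∑ i, p i + γ * ∑ i, |p i|) ≤ C * ∑ i, |s i| := by
    have h := sum_le_sum fun i (_ : i ∈ univ) => (hcell i).1
    simp only [sum_sub_distrib, sum_add_distrib, mul_add, ← mul_sum] at h
    linarith
  have h2 : (1 - δ) * (∑ i, p i - γ * ∑ i, |p i|) - ∑ i, s i ≤ C * ∑ i, |s i| := by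
    have h := sum_le_sum fun i (_ : i ∈ univ) => (hcell i).2
    simp only [sum_sub_distrib, mul_sub, ← mul_sum] at h
    linarith
  have hPabs : 0 ≤ ∑ i, |p i| := sum_nonneg fun i _ => abs_nonneg _
  have hL : 0 ≤ ∑ i, |s i| := sum_nonneg fun i _ => abs_nonneg _
  generalize ∑ i, p i = P at h1 h2 ⊢
  generalize ∑ i, |p i| = Pa at h1 h2 hPabs ⊢
  generalize ∑ i, s i = S at h1 h2 ⊢
  generalize ∑ i, |s i| = L at h1 h2 hL ⊢
  have hCL : 0 ≤ C * L := mul_nonneg hC hL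
  by_cases hhi : S ≤ P + γ * Pa
  · by_cases hlo : P - γ * Pa ≤ S
    · -- `S` itself is an admissible accumulation value: take `acc = c = S`
      refine ⟨S, S, ?_, ?_, ?_⟩
      · rw [abs_le]; constructor <;> linarith
      · rw [sub_self, abs_zero]; exact mul_nonneg hδ0 (abs_nonneg _)
      · rw [sub_self, abs_zero]; exact hCL
    · -- `S` below the accumulation band: accumulate LOW, then move the output down toward `S`
      push Not at hlo
      set A := P - γ * Pa with hA
      refine ⟨A, max S (A - δ * |A|), ?_, ?_, ?_⟩
      · rw [hA, abs_le]; constructor <;> nlinarith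
      · have hge : A - δ * |A| ≤ max S (A - δ * |A|) := le_max_right _ _
        have hle : max S (A - δ * |A|) ≤ A :=
          max_le hlo.le (by nlinarith [abs_nonneg A])
        rw [abs_le]; constructor <;> linarith
      · rcases le_total S (A - δ * |A|) with h | h
        · rw [max_eq_right h, abs_of_nonneg (by linarith)]
          have : δ * A ≤ δ * |A| := mul_le_mul_of_nonneg_left (le_abs_self A) hδ0
          linarith
        · rw [max_eq_left h, sub_self, abs_zero]; exact hCL
  · -- `S` above the accumulation band: accumulate HIGH, then move the output up toward `S`
    push Not at hhi
    set A := P + γ * Pa with hA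
    refine ⟨A, min S (A + δ * |A|), ?_, ?_, ?_⟩
    · rw [hA, abs_le]; constructor <;> nlinarith
    · have hle : min S (A + δ * |A|) ≤ A + δ * |A| := min_le_right _ _
      have hge : A ≤ min S (A + δ * |A|) :=
        le_min hhi.le (by nlinarith [abs_nonneg A])
      rw [abs_le]; constructor <;> linarith
    · rcases le_total (A + δ * |A|) S with h | h
      · rw [min_eq_right h, abs_of_nonpos (by linarith)]
        have : δ * -|A| ≤ δ * A := mul_le_mul_of_nonneg_left (neg_abs_le A) hδ0
        linarith
      · rw [min_eq_left h, sub_self, abs_zero]; exact hCL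

/-! ## The law, generic half 2: above the onset a constant-ratio input separates for every realisation -/

/-- **THE ONSET LAW, WITNESS HALF (record-generic)**: `N > 0` equal cells, exact value `S > 0`, quantised
value `P > 0`, caps `γ̄ < 1`, `δ̄ < 1`.  If `(C + 1)·S < (1 - γ̄)(1 - δ̄)·P` then EVERY realisation
(`γ ≤ γ̄`, `δ ≤ δ̄`) has `C·(N·|S|) < |c - N·S|`.  Part (o)'s `pipeline_witness_up` is the instance
`(γ̄, δ̄) = (1/2048, 1/257)`. [cite: Higham2002ASNA, §3.1] -/
theorem pipeline_witness_up_of_caps {N P S C γb δb γ δ acc c : ℚ} (hN : 0 < N) (hP : 0 < P)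
    (hS : 0 < S) (hγb : γb < 1) (hδb : δb < 1) (hγ : γ ≤ γb) (hδ : δ ≤ δb)
    (hacc : |acc - N * P| ≤ γ * (N * |P|)) (hc : |c - acc| ≤ δ * |acc|)
    (hnum : (C + 1) * S < (1 - γb) * (1 - δb) * P) :
    C * (N * |S|) < |c - N * S| := by
  have hQpos : 0 < N * P := mul_pos hN hP
  rw [abs_of_pos hP] at hacc
  have hacc' : N * P - γ * (N * P) ≤ acc := by
    have := (abs_le.mp hacc).1; linarith
  have hγQ : γ * (N * P) ≤ γb * (N * P) := mul_le_mul_of_nonneg_right hγ hQpos.le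
  have h1Q : 0 < (1 - γb) * (N * P) := mul_pos (by linarith) hQpos
  have haccpos : 0 < acc := by nlinarith
  have hc' : acc - δ * acc ≤ c := by
    have := (abs_le.mp hc).1; rw [abs_of_pos haccpos] at this; linarith
  have hδacc : δ * acc ≤ δb * acc := mul_le_mul_of_nonneg_right hδ haccpos.le
  have hclow : (1 - δb) * ((1 - γb) * (N * P)) ≤ c := by
    have h1 : (1 - δb) * acc ≤ c := by nlinarith
    have h2 : (1 - δb) * ((1 - γb) * (N * P)) ≤ (1 - δb) * acc :=
      mul_le_mul_of_nonneg_left (by nlinarith) (by linarith)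
    linarith
  have hkey := mul_lt_mul_of_pos_left hnum hN
  have hgoal : C * (N * S) < c - N * S := by nlinarith
  rw [abs_of_pos hS]
  rcases le_or_gt (c - N * S) 0 with h | h
  · exact lt_of_lt_of_le (lt_of_lt_of_le hgoal h) (abs_nonneg _)
  · rw [abs_of_pos h]; exact hgoal

/-- A rational strictly between `m > 0` and `√T` when `m² < T` (used to place a witness value strictly
inside an open onset window). -/
theorem exists_rat_gt_sq_lt {m T : ℚ} (hm : 0 < m) (hmT : m ^ 2 < T) :
    ∃ v : ℚ, m < v ∧ v ^ 2 < T := by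
  set d := T - m ^ 2 with hd
  have hdpos : 0 < d := by rw [hd]; linarith
  have hden : 0 < 2 * m + 2 + d := by linarith
  refine ⟨m + d / (2 * m + 2 + d), ?_, ?_⟩
  · have : 0 < d / (2 * m + 2 + d) := div_pos hdpos hden
    linarith
  · set e := d / (2 * m + 2 + d) with he
    have he0 : 0 < e := div_pos hdpos hden
    have he1 : e < 1 := by rw [he, div_lt_one hden]; linarith
    have hed : e * (2 * m + 2 + d) = d := by rw [he]; field_simp
    have : (m + e) ^ 2 = m ^ 2 + e * (2 * m + e) := by ring
    rw [this]
    have : e * (2 * m + e) < e * (2 * m + 2 + d) := by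
      apply mul_lt_mul_of_pos_left _ he0; linarith
    linarith

/-! ## The MX-E4M3 (ceil) ratio band on `C(κ)`, `κ ≤ 229376/15` -/

/-- **MX-E4M3 RATIO BAND.**  On a block of `C(κ)` with `κ ≤ 229376/15` every MX-E4M3-ceil quantised element
is a non-negative multiple `ρ·v` of the exact element with `16/17 ≤ ρ ≤ R` for any `R ≥ 18/17` with
`κ ≤ 14336·R`: a normal element (`|v|/X ≥ 1/64`) has `|ρ - 1| ≤ 1/17`; a sliver element
(`15/1024 < |v|/X < 1/64`, forced by `X·224 < κ|v|` and `κ ≤ 229376/15`) rounds UP to the smallest normal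
`X/64`, ratio `X/(64|v|) < κ/14336`. [cite: RouhaniEtAl2023MX, §5.1] -/
theorem mxCeil_ratio_band {k : ℕ} (V : Fin k → ℚ) (i : Fin k) {κ R : ℚ}
    (hκ : V i = 0 ∨ blockMax V ≤ κ * |V i|) (hκM : κ ≤ 229376 / 15) (hR : 18 / 17 ≤ R)
    (hκR : κ ≤ 14336 * R) :
    ∃ ρ : ℚ, 16 / 17 ≤ ρ ∧ ρ ≤ R ∧
      ceilScale E4M3 V * (roundNE E4M3 (V i / ceilScale E4M3 V)).toRat = ρ * V i := by
  have hM : E4M3.maxRat = 448 := by decide +kernel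
  have hM0 : 0 < E4M3.maxRat := by rw [hM]; norm_num
  by_cases hVi : V i = 0
  · refine ⟨1, by norm_num, by linarith, ?_⟩
    rw [hVi, scaled_zero, mul_zero]
  have hκ' : blockMax V ≤ κ * |V i| := hκ.resolve_left hVi
  have hpos : 0 < |V i| := abs_pos.mpr hVi
  have hX : 0 < ceilScale E4M3 V := ceilScale_pos E4M3 V
  have hB : 0 < blockMax V := lt_of_lt_of_le hpos (abs_le_blockMax V i)
  have hlt := ceilScale_mul_maxRat_lt_two_mul hM0 hB
  rw [hM] at hlt
  have h224 : ceilScale E4M3 V * 224 < κ * |V i| := by linarith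
  by_cases hn : 1 / 64 ≤ |V i| / ceilScale E4M3 V
  · -- normal element: relative error `≤ 1/17`
    have h := scaled_rel_error_le E4M3 hX (by rw [e4m3_envelope_constants.2.2.2.2.1]; exact hn)
      (mxCeil_scaled_le_maxRat E4M3 V i hM0)
    rw [e4m3_envelope_constants.1] at h
    have hρ : |ceilScale E4M3 V * (roundNE E4M3 (V i / ceilScale E4M3 V)).toRat / V i - 1| ≤ 1 / 17 := by
      rw [show ceilScale E4M3 V * (roundNE E4M3 (V i / ceilScale E4M3 V)).toRat / V i - 1
          = (ceilScale E4M3 V * (roundNE E4M3 (V i / ceilScale E4M3 V)).toRat - V i) / V i by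
            field_simp, abs_div, div_le_iff₀ hpos]
      exact h
    obtain ⟨hρ1, hρ2⟩ := abs_le.mp hρ
    refine ⟨ceilScale E4M3 V * (roundNE E4M3 (V i / ceilScale E4M3 V)).toRat / V i, by linarith,
      by linarith, ?_⟩
    rw [div_mul_cancel₀ _ hVi]
  · -- sliver element: rounds up to the smallest normal `X/64`
    have h2 : |V i| / ceilScale E4M3 V < 1 / 64 := not_le.mp hn
    have hy1 : 15 / 1024 < |V i| / ceilScale E4M3 V := by
      rw [lt_div_iff₀ hX]
      have h1 : κ * |V i| ≤ 229376 / 15 * |V i| := mul_le_mul_of_nonneg_right hκM hpos.le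
      linarith
    have hq : (roundNE E4M3 (|V i| / ceilScale E4M3 V)).toRat = 1 / 64 :=
      toRat_roundNE_E4M3_eq_inv64 hy1 h2.le
    have hvX : |V i| < ceilScale E4M3 V / 64 := by rw [div_lt_iff₀ hX] at h2; linarith
    have h1 : κ * |V i| ≤ 14336 * R * |V i| := mul_le_mul_of_nonneg_right hκR hpos.le
    refine ⟨ceilScale E4M3 V / 64 / |V i|, ?_, ?_, ?_⟩
    · rw [le_div_iff₀ hpos]; linarith
    · rw [div_le_iff₀ hpos]; linarith
    · rcases lt_or_gt_of_ne hVi with hneg | hposv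
      · have e : V i / ceilScale E4M3 V = -(|V i| / ceilScale E4M3 V) := by
          rw [abs_of_neg hneg]; ring
        rw [e, toRat_roundNE_neg, hq, abs_of_neg hneg]
        field_simp
      · rw [abs_of_pos hposv] at hq ⊢
        rw [hq]
        field_simp

/-- The cell form of the band: a quantised cell `q̂a·q̂b` is `r·(a·b)` with `256/289 ≤ r ≤ R²`. -/
theorem mxCeil_cell_ratio {k : ℕ} (U V : Fin k → ℚ) (i : Fin k) {κ R : ℚ}
    (hU : U i = 0 ∨ blockMax U ≤ κ * |U i|) (hV : V i = 0 ∨ blockMax V ≤ κ * |V i|)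
    (hκM : κ ≤ 229376 / 15) (hR : 18 / 17 ≤ R) (hκR : κ ≤ 14336 * R) :
    ∃ r : ℚ, 256 / 289 ≤ r ∧ r ≤ R ^ 2 ∧
      (ceilScale E4M3 U * (roundNE E4M3 (U i / ceilScale E4M3 U)).toRat) *
        (ceilScale E4M3 V * (roundNE E4M3 (V i / ceilScale E4M3 V)).toRat) = r * (U i * V i) := by
  obtain ⟨ρ, hρ1, hρ2, hρ⟩ := mxCeil_ratio_band U i hU hκM hR hκR
  obtain ⟨σ, hσ1, hσ2, hσ⟩ := mxCeil_ratio_band V i hV hκM hR hκR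
  refine ⟨ρ * σ, ?_, ?_, ?_⟩
  · have := mul_le_mul hρ1 hσ1 (by norm_num) (le_trans (by norm_num) hρ1)
    linarith
  · rw [sq]; exact mul_le_mul hρ2 hσ2 (le_trans (by norm_num) hσ1) (le_trans (le_trans (by norm_num) hρ1) hρ2)
  · rw [hρ, hσ]; ring

/-- From the class `C(κ)` (global numerator `A`) to the block-relative hypothesis of the band. -/
theorem class_blockMax_le {B k : ℕ} (a : Fin B → Fin k → ℚ) {Aa κ : ℚ}
    (ha : ∀ j i, |a j i| ≤ Aa ∧ (a j i = 0 ∨ Aa ≤ κ * |a j i|)) (j : Fin B) (i : Fin k) :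
    a j i = 0 ∨ blockMax (a j) ≤ κ * |a j i| :=
  (ha j i).2.imp_right fun h => le_trans
    (blockMax_le_of_forall_le (le_trans (abs_nonneg _) (ha j i).1) fun i' => (ha j i').1) h

end Summit.Ventures.CertifiedArithmetic.LowPrec.GemmEnvelope
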